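import Summits.Ventures.HSemireg.UntwistCocycleTwistAtiyahHigher
import HarnessLib

/-!
# Venture HSemireg — route R1.0, untwisted reading, rows `q ≥ 2` input (L6): **the trace with coefficients is
# linear over Čech classes of LOCAL morphisms of coefficients** — `Tr_{G'}(y · [ψ ↦ ψ ≫ t]) = Tr_G(y) · [t]`, and
# `Tr_{Ωʲ⁺¹}(y · [ν′_j]) = Tr_{Ωʲ}(y) · [dlog g ∧ –]` (gs-g4; `general-structure/LEIBNIZ-ROW2-PLAN-gs-g4.md` §5 (L6))

HONEST FRAMING. Module-level homological algebra on the tree's REAL carriers (the trace with coefficients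
`traceExtCoeff` of `HodgeTheory/AtiyahClassTraceReal.lean`, Čech classes `classOf`, th-4's cocycle twist `E⟨c⟩`).
Nothing about any variety; no gerbe; nothing here says HC, HC_CM or HC_AV is proved.

WHAT IS PROVED. `UntwistCocycleTwistScalarTrace.lean` proved `Tr_G(y · [e ↦ e ⊗ ω]) = Tr(y) · [r ↦ r ω]` — the trace
with coefficients is linear over the Čech class of a cochain of SECTIONS `ω` of `G`. The rows `q ≥ 2` of the Leibniz
re-expansion `hσ` need the same for a cochain of LOCAL MORPHISMS of coefficients `t_{ab} : G|_{U_{ab}} → G'|_{U_{ab}}`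
(the wedge `ω_{ab} ∧ – : Ωʲ → Ωʲ⁺¹`):

* `contract_app_comp_postcompOver` — in a frame, `c_{G'}(Ψ ≫ (ψ ↦ ψ ≫ t)) = t(c_G(Ψ))`;
* `sheafHomMap_familyHom_exchange_contract_postcomp` — the cochain identity
  `𝓗om(F, ν♯) ≫ κ_{c_{G'}} = c_G ≫ t♯ : 𝓗om(F, F ⊗ G) → Č¹(𝓤, G')` for `ν = (ψ ↦ ψ ≫ t)` on `F ⊗ G = 𝓗om(F^∨, G)`;
* `mapExactFunctor_classOf_homPostcompFamily_comp_contract` — `𝓗om(F, [ν]) · [c_{G'}] = [c_G] · [t]` in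
  `Ext¹(𝓗om(F, F ⊗ G), G')`;
* **`traceExtCoeff_comp_classOf_homPostcompFamily`** — `Tr_{G'}(y · [ν]) = Tr_G(y) · [t]` in `Extⁿ⁺¹(𝒪_X, G')` for EVERY
  `y ∈ Extⁿ(F, F ⊗ G)`, `F` finite locally free (Buchweitz–Flenner's `Tr(y · (1 ⊗ κ)) = Tr(y) ∪ κ`, §4);
* the cocycle twist: the cochain of local morphisms `ω_{xy} ∧ – : Ωʲ → Ωʲ⁺¹` (`ω_{xy} = -g_{xy} dg_{yx}`) is a cocycle
  (`dFamily_wedgeHomAt_dlogForm`), its Čech class `[dlog g] ∧ – ∈ Ext¹(Ωʲ, Ωʲ⁺¹)`, the identification of its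
  post-composition cochain on `E⟨c⟩ ⊗ Ωʲ` with the cochain `ν′_j` of `UntwistCocycleTwistAtiyahHigher.atiyahClassStep_twist`
  (`postcompOver_wedgeHomAt_dlogForm_eq_twistWedgeFamily`, `rfl`), and
  **`traceExtCoeff_twist_comp_twistWedgeClass`**: `Tr^{E⟨c⟩}_{Ωʲ⁺¹}(y · [ν′_j]) = Tr^{E⟨c⟩}_{Ωʲ}(y) · ([dlog g] ∧ –)` for
  every `y ∈ Extⁿ(E⟨c⟩, E⟨c⟩ ⊗ Ωʲ)`.

Which Ext groups: `Extⁿ(E⟨c⟩, E⟨c⟩ ⊗ Ωʲ)`, `Extⁿ⁺¹(𝒪_X, Ωʲ⁺¹)`; which class: `[dlog g] ∧ –`; which twist: `- ⊗ M_B`.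

## References

* R.-O. Buchweitz, H. Flenner, *A semiregularity map for modules and applications to deformations*, Compositio
  Math. 137 (2003), §4 (the trace `Tr : Ext^k(F, F ⊗ G) → H^k(X, G)` and its linearity). [BuchweitzFlenner2003]
* M. F. Atiyah, *Complex analytic connections in fibre bundles*, Trans. AMS 85 (1957), Prop. 12. [Atiyah1957]
* R. Hartshorne, *Algebraic Geometry* (1977), III.4 (Čech), II Ex. 5.1 (b). [Hartshorne1977]
-/

noncomputable section

open CategoryTheory CategoryTheory.Abelian AlgebraicGeometry Opposite TopologicalSpace Limits

namespace Summit.Ventures.HSemireg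

namespace CocycleTwist

open Literature.AlgebraicGeometry.Modules Literature.AlgebraicGeometry.Motives
  Literature.AlgebraicGeometry.HodgeTheory Literature.AlgebraicGeometry.Modules.Cech Literature.Algebra.Homology

universe u

variable {S : Type u} [CommRing S] {X : Over (Spec (CommRingCat.of S))}

/-! ### Post-composition with local morphisms: restriction and the contraction in a frame -/

section Postcomp

variable {A B B' : X.left.Modules} {W V : X.left.Opens}

/-- `(ψ ↦ ψ ≫ t)|_V = (ψ ↦ ψ ≫ t|_V)`. [folklore] -/
theorem restrictHom_postcompOver' (i : V ⟶ W) (t : B.over W ⟶ B'.over W) :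
    restrictHom i (postcompOver A t) = postcompOver A (restrictHom i t) :=
  hom_ext_of_appLE fun W' k (ψ : A.over W' ⟶ B.over W') => by
    rw [appLE_restrictHom, appLE_postcompOver, appLE_postcompOver, restrictHom_comp']

variable {F G G' : X.left.Modules} (hF : IsFiniteLocallyFree F)

/-- **In a frame: `c_{G'}(Ψ ≫ (ψ ↦ ψ ≫ t)) = t(c_G(Ψ))`** (`Σ_i t(Ψ(b_i)(b_i^*)) = t(Σ_i Ψ(b_i)(b_i^*))`): the
contraction commutes with post-composition by a local morphism of coefficients. [cite: BuchweitzFlenner2003, §4 (trace map)] -/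
theorem contract_app_comp_postcompOver {I : Type u} [Fintype I] (f : SheafOfModules.free I ≅ F.over W)
    (Ψ : F.over W ⟶ (sheafHom (dual F) G).over W) (t : G.over W ⟶ G'.over W) :
    (contract hF G').app W (Ψ ≫ postcompOver (dual F) t) = appLE t (𝟙 W) ((contract hF G).app W Ψ) := by
  rw [contract_app_eq_frameContract hF G' f, contract_app_eq_frameContract hF G f, frameContract, frameContract,
    appLE_sum_right]
  refine Finset.sum_congr rfl fun i _ => ?_
  rw [appLE_comp, appLE_postcompOver, restrictHom_id']
  rfl

end Postcomp

/-! ### The cochain identity `𝓗om(F, ν♯) ≫ κ_{c_{G'}} = c_G ≫ t♯` -/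

section Cochain

variable {ι : Type u} {U : ι → X.left.Opens} {F G G' : X.left.Modules} (hF : IsFiniteLocallyFree F)
  (t : LocalFamily U 1 G G')

/-- **The cochain identity `𝓗om(F, ν♯) ≫ κ_{c_{G'}} = c_G ≫ t♯ : 𝓗om(F, F ⊗ G) → Č¹(𝓤, G')`**: the `ab`-component
of `c_{G'}(Ψ ≫ ν)` is `t_{ab}(c_G(Ψ))`. [cite: BuchweitzFlenner2003, §4 (trace map)] -/
theorem sheafHomMap_familyHom_exchange_contract_postcomp :
    sheafHomMap F (familyHom (fun β => postcompOver (dual F) (t β) : LocalFamily U 1 (sheafHom (dual F) G) (sheafHom (dual F) G'))) ≫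
        exchange 1 (contract hF G') =
      contract hF G ≫ familyHom t := by
  refine hom_ext_of_frames hF fun W I _ f (Ψ : F.over W ⟶ (sheafHom (dual F) G).over W) => ?_
  rw [Scheme.Modules.Hom.comp_app, CategoryTheory.comp_apply, Scheme.Modules.Hom.comp_app,
    CategoryTheory.comp_apply, sheafHomMap_app_apply]
  refine funext fun α => ?_
  rw [exchange_app_apply, componentOver_comp, componentOver_over_map_familyHom, familyHom_app_apply,
    restrictHom_postcompOver',
    contract_app_comp_postcompOver hF
      (SheafOfModules.restrictTrivialisation (R := X.left.ringCatSheaf) (homOfLE inf_le_left) f),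
    Cech.app_restrictHom (contract hF G) (inf_le_left : W ⊓ face U α ≤ W) Ψ, appLE_restrictHom]
  rfl

end Cochain

/-! ### `𝓗om(F, [ν]) · [c_{G'}] = [c_G] · [t]` and `Tr_{G'}(y · [ν]) = Tr_G(y) · [t]` -/

section Trace

variable {ι : Type u} {U : ι → X.left.Opens} (hU : iSup U = ⊤) {F G G' : X.left.Modules}
  (hF : IsFiniteLocallyFree F) (t : LocalFamily U 1 G G') (ht : dFamily t = 0)
  (hν : dFamily (fun β => postcompOver (dual F) (t β) : LocalFamily U 1 (sheafHom (dual F) G) (sheafHom (dual F) G')) = 0)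
  [HasExt.{u + 1} X.left.Modules]

/-- **`𝓗om(F, [ν]) · [c_{G'}] = [c_G] · [t]` in `Ext¹(𝓗om(F, F ⊗ G), G')`** for the post-composition cochain
`ν = (ψ ↦ ψ ≫ t)` of a cocycle of local morphisms of coefficients `t` (`θ` commutes with `𝓗om(F, –)`, is natural
along `κ_{c_{G'}}`, and the cochain identity `sheafHomMap_familyHom_exchange_contract_postcomp`).
[cite: BuchweitzFlenner2003, §4 (trace map)] -/
theorem mapExactFunctor_classOf_homPostcompFamily_comp_contract :
    haveI := preservesFiniteColimits_sheafHomFunctor F hF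
    ((classOf (exactAugmentation U (sheafHom (dual F) G') hU) (fun β => postcompOver (dual F) (t β) : LocalFamily U 1 (sheafHom (dual F) G) (sheafHom (dual F) G')) hν).mapExactFunctor
        (sheafHomFunctor F)).comp (Ext.mk₀ (contract hF G')) (add_zero 1) =
      (Ext.mk₀ (contract hF G)).comp (classOf (exactAugmentation U G' hU) t ht) (zero_add 1) := by
  haveI := preservesFiniteColimits_sheafHomFunctor F hF
  have hωK : familyHom ((fun β => postcompOver (dual F) (t β))) ≫ (complex U (sheafHom (dual F) G')).d 1 (1 + 1) = 0 :=
    familyHom_comp_d_eq_zero _ hν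
  have hΦ : (sheafHomFunctor F).map (familyHom ((fun β => postcompOver (dual F) (t β)))) ≫
      (ExactAugmentation.mapK (sheafHomFunctor F) (complex U (sheafHom (dual F) G'))).d 1 (1 + 1) = 0 :=
    ExactAugmentation.map_d_eq_zero (K := complex U (sheafHom (dual F) G')) (sheafHomFunctor F) _ hωK
  have hκ : ((sheafHomFunctor F).map (familyHom ((fun β => postcompOver (dual F) (t β)))) ≫
      (exchangeChainMap U (sheafHom (dual F) G') (contract hF G')).f 1) ≫ (complex U G').d 1 (1 + 1) = 0 :=
    ExactAugmentation.comp_f_d_eq_zero (exchangeChainMap U _ (contract hF G')) _ hΦ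
  have hμ : ((exactAugmentation U (sheafHom (dual F) G') hU).mapFunctor (sheafHomFunctor F)).ε ≫
      (exchangeChainMap U (sheafHom (dual F) G') (contract hF G')).f 0 =
        contract hF G' ≫ (exactAugmentation U G' hU).ε :=
    exchange_augment (contract hF G')
  have hts : (contract hF G ≫ familyHom t) ≫ (complex U G').d 1 (1 + 1) = 0 := by
    rw [Category.assoc, familyHom_comp_d_eq_zero _ ht, Limits.comp_zero]
  have e1 : (classOf (exactAugmentation U (sheafHom (dual F) G') hU) ((fun β => postcompOver (dual F) (t β))) hν).mapExactFunctor
        (sheafHomFunctor F) =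
      ((exactAugmentation U (sheafHom (dual F) G') hU).mapFunctor (sheafHomFunctor F)).theta
        ((sheafHomFunctor F).map (familyHom ((fun β => postcompOver (dual F) (t β))))) hΦ :=
    (ExactAugmentation.theta_mapFunctor (sheafHomFunctor F) (exactAugmentation U _ hU) _ hωK hΦ).symm
  have e2 : (((exactAugmentation U (sheafHom (dual F) G') hU).mapFunctor (sheafHomFunctor F)).theta
        ((sheafHomFunctor F).map (familyHom ((fun β => postcompOver (dual F) (t β))))) hΦ).comp (Ext.mk₀ (contract hF G'))
        (add_zero 1) =
      (exactAugmentation U G' hU).theta ((sheafHomFunctor F).map (familyHom ((fun β => postcompOver (dual F) (t β)))) ≫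
        (exchangeChainMap U (sheafHom (dual F) G') (contract hF G')).f 1) hκ :=
    (ExactAugmentation.theta_comp_map ((exactAugmentation U _ hU).mapFunctor (sheafHomFunctor F))
      (exactAugmentation U G' hU) (exchangeChainMap U _ (contract hF G')) (contract hF G') hμ _ hΦ hκ).symm
  have e3 : (exactAugmentation U G' hU).theta ((sheafHomFunctor F).map (familyHom ((fun β => postcompOver (dual F) (t β)))) ≫
        (exchangeChainMap U (sheafHom (dual F) G') (contract hF G')).f 1) hκ =
      (exactAugmentation U G' hU).theta (contract hF G ≫ familyHom t) hts :=
    (exactAugmentation U G' hU).theta_congr (by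
      rw [exchangeChainMap_f]; exact sheafHomMap_familyHom_exchange_contract_postcomp hF t) _ _
  rw [e1, e2, e3, classOf_def]
  exact (exactAugmentation U G' hU).theta_comp_left (contract hF G) (familyHom t) (familyHom_comp_d_eq_zero _ ht)

/-- **`Tr_{G'}(y · [ν]) = Tr_G(y) · [t]` in `Extⁿ⁺¹(𝒪_X, G')`** for EVERY `y ∈ Extⁿ(F, F ⊗ G)` (`F` finite locally free),
the post-composition cochain `ν = (ψ ↦ ψ ≫ t)` and the cocycle of local morphisms of coefficients `t : G → G'` on the
overlaps: the trace with coefficients is linear over Čech classes of local morphisms of coefficients —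
Buchweitz–Flenner's `Tr(y · (1 ⊗ κ)) = Tr(y) ∪ κ`. [cite: BuchweitzFlenner2003, §4 (trace map)] -/
theorem traceExtCoeff_comp_classOf_homPostcompFamily {n : ℕ} (y : Ext.{u + 1} F (sheafHom (dual F) G) n) :
    traceExtCoeff hF G' (n + 1)
        (y.comp (classOf (exactAugmentation U (sheafHom (dual F) G') hU) ((fun β => postcompOver (dual F) (t β))) hν) rfl) =
      (traceExtCoeff hF G n y).comp (classOf (exactAugmentation U G' hU) t ht) rfl := by
  haveI := preservesFiniteColimits_sheafHomFunctor F hF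
  rw [traceExtCoeff_apply, traceExtCoeff_apply, Ext.mapExactFunctor_comp,
    Ext.comp_assoc _ _ _ (rfl : n + 1 = n + 1) (add_zero 1) (show n + 1 + 0 = n + 1 by omega),
    mapExactFunctor_classOf_homPostcompFamily_comp_contract hU hF t ht hν]
  symm
  rw [Ext.comp_assoc _ _ _ (zero_add n) (rfl : n + 1 = n + 1) (show 0 + n + 1 = n + 1 by omega)]
  congr 1
  exact Ext.comp_assoc_of_second_deg_zero _ _ _ _

end Trace

/-! ### The cocycle twist: `ν′_j = (ψ ↦ ω_{xy} ∧ ψ)` and `[dlog g] ∧ – ∈ Ext¹(Ωʲ, Ωʲ⁺¹)` -/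

section Twist

variable (c : UnitCocycle X.left) (j : ℕ) (W : X.left → X.left.Opens) (hWU : ∀ x, W x ≤ c.U x)

/-- The post-composition cochain on `E⟨c⟩ ⊗ Ωʲ` of the cochain of local morphisms `ω_{xy} ∧ – : Ωʲ → Ωʲ⁺¹`
(`ω_{xy} = -g_{xy} d g_{yx}`, cover `W_x ⊆ U_x`) IS the cochain `ν′_j` of
`UntwistCocycleTwistAtiyahHigher.atiyahClassStep_twist`. [folklore] -/
theorem postcompOver_wedgeHomAt_dlogForm_eq_twistWedgeFamily (E : X.left.Modules) :
    (fun β => postcompOver (dual (twist c E)) (wedgeHomAt j (dlogForm c (β 0) (β 1) (face W β)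
        ((face_le _ β 0).trans (hWU (β 0))) ((face_le _ β 1).trans (hWU (β 1))))) :
        LocalFamily W 1 (twistHodge (twist c E) j) (twistHodge (twist c E) (j + 1))) =
      twistWedgeFamily c E j W hWU := rfl

/-- **The cochain of local morphisms `ω_{xy} ∧ – : Ωʲ|_{W_{xy}} → Ωʲ⁺¹|_{W_{xy}}` is a cocycle**
(`ω_{xy} = -g_{xy} d g_{yx}` the `dlog` cochain of `c` on a cover `W_x ⊆ U_x`: `ω_{yz} - ω_{xz} + ω_{xy} = 0`, and `∧`
is additive in the `1`-form). [cite: Atiyah1957, Prop. 12] -/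
theorem dFamily_wedgeHomAt_dlogForm :
    dFamily (fun β => wedgeHomAt j (dlogForm c (β 0) (β 1) (face W β) ((face_le _ β 0).trans (hWU (β 0)))
        ((face_le _ β 1).trans (hWU (β 1)))) : LocalFamily W 1 (hodgeSheaf X j) (hodgeSheaf X (j + 1))) = 0 := by
  funext β
  have hV0 : face W β ≤ c.U (β 0) := (face_le _ β 0).trans (hWU (β 0))
  have hV1 : face W β ≤ c.U (β 1) := (face_le _ β 1).trans (hWU (β 1))
  have hV2 : face W β ≤ c.U (β 2) := (face_le _ β 2).trans (hWU (β 2))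
  rw [dFamily, Fin.sum_univ_three, Pi.zero_apply]
  simp only [Fin.val_zero, pow_zero, one_smul, Fin.val_one, pow_one, neg_one_zsmul, Fin.val_two, neg_one_sq,
    restrictHom_wedgeHomAt, map_dlogForm]
  change wedgeHomAt j (dlogForm c (β 1) (β 2) (face W β) hV1 hV2) + -wedgeHomAt j (dlogForm c (β 0) (β 2) (face W β) hV0 hV2) +
      wedgeHomAt j (dlogForm c (β 0) (β 1) (face W β) hV0 hV1) = 0
  rw [← wedgeHomAt_neg, ← wedgeHomAt_add, ← wedgeHomAt_add, ← sub_eq_add_neg, dlogForm_cocycle, wedgeHomAt,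
    evalAt_zero, Limits.comp_zero]

variable [HasExt.{u + 1} X.left.Modules] (hW : iSup W = ⊤)

variable {E : X.left.Modules} (hE : IsFiniteLocallyFree E)

/-- **`Tr^{E⟨c⟩}_{Ωʲ⁺¹}(y · [ν′_j]) = Tr^{E⟨c⟩}_{Ωʲ}(y) · ([dlog g] ∧ –)`** in `Extⁿ⁺¹(𝒪_X, Ωʲ⁺¹)`, for every
`y ∈ Extⁿ(E⟨c⟩, E⟨c⟩ ⊗ Ωʲ)`: `ν′_j` the cochain `ψ ↦ ω_{xy} ∧ ψ` of `atiyahClassStep_twist` on the cover `W_x ⊆ U_x`, and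
`[dlog g] ∧ – ∈ Ext¹(Ωʲ, Ωʲ⁺¹)` the Čech class of the cocycle of local morphisms `ω_{xy} ∧ –` (the Yoneda multiplication by
the Atiyah class / first Chern class of `M = lineBundle c` in Hodge cohomology on `j`-forms, up to the sign convention
of `ω`). [cite: BuchweitzFlenner2003, §4 (trace map); Atiyah1957, Prop. 12] -/
theorem traceExtCoeff_twist_comp_twistWedgeClass {n : ℕ}
    (y : Ext.{u + 1} (twist c E) (twistHodge (twist c E) j) n) :
    traceExtCoeff (isFiniteLocallyFree_twist c hE) (hodgeSheaf X (j + 1)) (n + 1)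
        (y.comp (classOf (exactAugmentation W _ hW) (twistWedgeFamily c E j W hWU)
          (dFamily_twistWedgeFamily c E j W hWU)) rfl) =
      (traceExtCoeff (isFiniteLocallyFree_twist c hE) (hodgeSheaf X j) n y).comp
        (classOf (exactAugmentation W _ hW) (fun β => wedgeHomAt j (dlogForm c (β 0) (β 1) (face W β) ((face_le _ β 0).trans (hWU (β 0)))
          ((face_le _ β 1).trans (hWU (β 1)))) : LocalFamily W 1 (hodgeSheaf X j) (hodgeSheaf X (j + 1)))
          (dFamily_wedgeHomAt_dlogForm c j W hWU)) rfl :=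
  traceExtCoeff_comp_classOf_homPostcompFamily hW (isFiniteLocallyFree_twist c hE) _
    (dFamily_wedgeHomAt_dlogForm c j W hWU) (dFamily_twistWedgeFamily c E j W hWU) y

end Twist

end CocycleTwist

end Summit.Ventures.HSemireg

end
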